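import Summits.Parity.GeneralizedHardyLittlewood.Theorems.Dhl42DataH26
import Summits.Parity.GeneralizedHardyLittlewood.Theorems.Dhl42DataH33
import Summits.Parity.GeneralizedHardyLittlewood.Theorems.Dhl42DataH39
import Summits.Parity.GeneralizedHardyLittlewood.Theorems.Dhl42DataH40
import Summits.Parity.GeneralizedHardyLittlewood.Theorems.Dhl42DataH41
import Summits.Parity.GeneralizedHardyLittlewood.Theorems.Dhl42DataH42
import Summits.Parity.GeneralizedHardyLittlewood.Theorems.Dhl42ClosedFormSetup

/-!
# DHL[42,2] certificate — kernel verification of the convolution-power checkpoints `H26`, `H33`, `H39` … `H42`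

Each theorem recomputes its left-hand side INSIDE THE LEAN KERNEL (`decide +kernel`: definitional
unfolding with the kernel's GMP `Nat`/`Int` arithmetic on core `Rat`; no `native_decide`, no
`Lean.ofReduceBool`, nothing compiled in the trusted base) and compares with the literals of
`Dhl42Data*`: starting from `GE = g²` (`Dhl42ClosedFormSetup`), 25 + 7 + 6 + 1 + 1 + 1 convolutions
reach the densities `G^{⋆39}` … `G^{⋆42}` used by the class pairings. Kernel time on the package
toolchain: ≈ 60 + 45 + 58 + 11 + 11 + 12 s (≈ 3.3 min for the file).

Origin: `Dhl42/ClosedForm/KernelH.lean` of the DHL[42,2] certificate package (pub-dhl42 bundle,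
archive blob `18cce9e3`; sha256[:16] of the file `5ff1614f524c45ff`; paper snapshot =
`paper/main.tex` v1), lines :24–:34; statements and proofs unchanged except: namespace
`Dhl42.ClosedForm` → `Summit.Parity.GeneralizedHardyLittlewood.Theorems.Dhl42.ClosedForm`,
`Dhl42.ExpPoly` → the tree's `Literature.Analysis.ValidatedNumerics.ExpPoly` (`ExpPoly/*.lean`,
batch B1), docstrings added where missing.

Declarations (6): `seg26`, `seg33`, `seg39`, `seg40`, `seg41`, `seg42`.
-/

-- `decide +kernel` below: the `Decidable` instances unfold `EP.canon` / `EP.conv` / `FS.norm` structurally over lists of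
-- hundreds of blocks with GMP-size rationals (deep recursion), and each kernel evaluation runs for 5–60 s on the package
-- toolchain — heartbeats meter only the elaborator's share, which must not abort a check the kernel completes
set_option maxRecDepth 100000
set_option maxHeartbeats 0

open Literature.Analysis.ValidatedNumerics.ExpPoly

namespace Summit.Parity.GeneralizedHardyLittlewood.Theorems.Dhl42.ClosedForm

/-- Kernel checkpoint 1: the canonical form of `GE^{⋆25} ⋆ GE` — the density `G^{⋆26}` of
`t₁ + ⋯ + t₂₆` under `Π G(t_j) dt_j`, `G = g²` — is the literal `H26` (`decide +kernel` recomputes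
25 convolutions from `GE`; ≈ 60 s of kernel time on the package toolchain). -/
theorem seg26 : EP.canon (EP.convIter GE 25 (ES.toEP GE)) = H26 := by decide +kernel

/-- Kernel checkpoint 2: seven further convolutions with `GE` take `H26` to the literal `H33`
(density `G^{⋆33}`; ≈ 45 s). -/
theorem seg33 : EP.canon (EP.convIter GE 7 H26) = H33 := by decide +kernel

/-- Kernel checkpoint 3: six further convolutions with `GE` take `H33` to the literal `H39` (density
`G^{⋆39}`, entering `J`-side pairing 4; ≈ 55 s). -/
theorem seg39 : EP.canon (EP.convIter GE 6 H33) = H39 := by decide +kernel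

/-- Kernel checkpoint 4: one convolution with `GE` takes `H39` to the literal `H40` (density
`G^{⋆40}`; ≈ 10 s). -/
theorem seg40 : EP.canon (EP.conv GE H39) = H40 := by decide +kernel

/-- Kernel checkpoint 5: one convolution with `GE` takes `H40` to the literal `H41` (density
`G^{⋆41}`; ≈ 10 s). -/
theorem seg41 : EP.canon (EP.conv GE H40) = H41 := by decide +kernel

/-- Kernel checkpoint 6: one convolution with `GE` takes `H41` to the literal `H42` (density
`G^{⋆42}`, the density of `I`-side pairing 1; ≈ 10 s). -/
theorem seg42 : EP.canon (EP.conv GE H41) = H42 := by decide +kernel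

end Summit.Parity.GeneralizedHardyLittlewood.Theorems.Dhl42.ClosedForm
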